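import Summits.BirchSwinnertonDyer.Rank1Residual.Additive.QuadraticBranchSignedMainConjecture
import HarnessLib

/-!
# The KATO HALF of (C1_η) on the quadratic branch — Kobayashi 2003 Thm. 2.2 + Thm. 4.1 at the
# component `η = ω^{(p−1)/2}`, read over `F = ℚ(√p*)` (THEOREM IN PRINT, typed as a READING) — and
# the residual EISENSTEIN HALF `Char X⁺(V/F_∞) ⊆ Char X⁺(V/ℚ_∞)·(L_p⁺(V,η,X))` (OPEN), with the
# kernel decomposition `(C1_η) ⟺ upper ∧ lower` (cell `bsd-potss`, seat `bsd-potss-k8q-c2`;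
# K8 crux `QuadraticBranchSignedControl.PlusMainConjectureBranch`, item stmt-BirchSwinnertonDyer-19114)

HONEST FRAMING (cell `bsd-potss`, run/shared/lean/pub/bsd-potss/; FULL-BSD rank ≤ 1 programme,
tranche 1b, HUMAN RULING D-0036; verbatim in every file): the target of record is FULL BSD for every
analytic-rank ≤ 1 curve over `ℚ`; this cell attacks rows B4/B5/B8 (additive potentially
supersingular primes). THIS FILE types TWO statements as `@[conjecture] def`s — ONE READING of a
printed theorem (Kobayashi's Thm. 2.2 + Thm. 4.1 for the sign `+` at the quadratic character `η`,
the Kato-side inclusion of his even main conjecture, in the cell's `ℚ(√p*)`-subtower currency of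
(C1_η)) and ONE OPEN statement (the converse, "Eisenstein", inclusion — OUR DECOMPOSITION of the
printed conjecture, not a statement in print) — and proves the bookkeeping between them and the
crux node (C1_η) `QuadraticBranchPlusMainConjectureAt`. TYPED INPUTS, nothing asserted; no named
Literature fact minted; no `sorry`, axioms standard; (C1_η) stays a CONJECTURE IN PRINT, OPEN for
non-CM `V`; the class served (Gss2 = O5 ∩ `e = 2`, `p ≥ 5`: 216 r0 + 157 r1 isogeny classes) stays
OPEN; nothing is booked; no label / mark / count of `RESIDUAL-MAP.md` moves. This is not
"finishing BSD".

## Why (the literature verdict of seat k8q-c2 on crux 19114, 2026-08-26)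

(C1_η) — Kobayashi's EVEN main conjecture for the good `a_p = 0` curve `V` on the component
`η = ω^{(p−1)/2}` of `Δ = Gal(ℚ(μ_p)/ℚ)`, typed over `F = ℚ(√p*)` as
`Char_Λ X⁺(V/F_∞) = Char_Λ X⁺(V/ℚ_∞) · (L_p⁺(V, η, X))` — is an EQUALITY of ideals of `Λ = ℤ_p⟦X⟧`
whose two inclusions have entirely different status in print:

* **`⊇` (Kato side) is a THEOREM**: Kobayashi, Invent. Math. 152 (2003), **Thm. 4.1** [p. 8,
  verbatim]: "There exists an integer `n ≥ 0` such that `Char(X⁺(E/K_∞)^η) ⊇ (pⁿ L_p⁺(E, η, X))`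
  […] If the `p`-adic representation `Gal(ℚ̄/ℚ) → GL_{ℤ_p}(T)` is surjective, then we can take
  `n = 0`." — for EVERY character `η` of `Δ` (proved in his §7 from Kato's Euler system, Kato 2004
  Thm. 12.5, component by component: the `η`-sequence
  `0 → H¹(T)^η/Z(T)^η → Λ^η/(L_p⁺(E,η,X)) → X⁺(E/K_∞)^η → X⁰(E/K_∞)^η → 0` of the proof of Thm. 7.4,
  p. 13), together with **Thm. 2.2** [p. 5]: `X^±(E/K_∞)` is a finitely generated torsion
  `ℤ_p[[G_∞]]`-module ("By Theorem 2.2, `X^±(E/K_∞)^η` is a torsion `ℤ_p[[Γ]]`-module", p. 8).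
  The tree vendors the `η = 1` component (`Kobayashi2003.thm41_signedCharIdeal_divisibility`,
  `thm12_signedSelmerDual_finite_torsion`) and the `p = 3` case over `ℚ(ζ₃)`
  (`thm41_plusCharIdeal_dvd_cyclotomicThree`), and lists the components `η ≠ 1` as TODO; §1 below
  types the quadratic component in the F-form currency of (C1_η).
* **`⊆` (Eisenstein side) is OPEN for non-CM `V`**: the known cases of the `±` main conjecture —
  Wan (semistable, `a_p = 0`), Sprung / Castella–Çiperiani–Skinner–Sprung (semistable),
  Burungale–Skinner–Tian–Wan arXiv:2409.01350 (PRE; twists by `χ_K` only for `disc K` COPRIME to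
  `Np`) — are on the TRIVIAL component of `Δ`; the component `η = χ_{p*}` is the Iwasawa theory of
  the ADDITIVE twist `W = V ⊗ η` at `p`, for which the only statement in the literature is the CLAIM
  of Fouquet–Wan arXiv:2107.13726 Thm. 5.1 (Kato's IMC for `f ∈ S_k(Γ₀(Np^r))`, arbitrary reduction at
  `p`, on the locus `ρ̄` abs. irreducible + non-split ramified Steinberg prime; UNREFEREED, its
  non-ordinary Eisenstein side resting on Wan's withdrawn 2015 preprint — tree
  `Additive/FouquetWanLocus.lean`, `FouquetWanClaimShape`, consumed only as a hypothesis), which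
  would give the `η`-component through Kobayashi's Thm. 7.4 at `η` and the zeta-element twist
  comparison (the cell's typed bridge `QuadraticBranchKatoBridge`, nothing asserted). For CM `V`
  (`p ≥ 5` inert in the CM field): Pollack–Rubin, Ann. of Math. 159 (2004), prove the trivial
  component and REMARK (p. 448) that "with the same proof (and a little extra notation) one can prove
  an analogous result for `Sel^±_p(E/ℚ(μ_{p^∞}))`"; Lei, Compositio 147 (2011) §7 / Cambridge thesis
  2010 Ch. 6 re-proves the CM case for modular forms again "with `θ = 1`" only — the `η ≠ 1`
  components of the CM case are NOT a theorem of the published record either.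

So the crux is, literally, `(printed theorem, modulo the descent reading) ∧ (open inclusion)`; this
file records that decomposition in the kernel so that the planner can re-cut item 19114 at the
seam (the Eisenstein half is also exactly what the rank-`0` LOWER half `ord_p #Ш_an ≤ ord_p #Ш`
consumes: `Char X ⊆ (L)` ⟹ `v_p L(0) ≤ ord_p #Sel + …`).

## The reading (flags for the referee: `Kob03-Thm41-eta-quadratic-subtower`, `Kob03-Lplus-eta-upto-unit`)

Exactly the reading under which (C1_η) itself is typed (`QuadraticBranchSignedMainConjecture.lean`,
module docstring "What is typed here"): `F = ℚ(√p*) ⊂ K_0 = ℚ(ζ_p)`, `Δ' = Gal(K_0/F)` of order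
`(p−1)/2` prime to `p`, `F_∞ = F·ℚ_∞ = K_∞^{Δ'}`; restriction gives `Sel⁺(V/F_n) ≅ Sel⁺(V/K_n)^{Δ'}`
(the PLUS condition of Def. 2.1 involves `0 ≤ m < n` only and `V⁺(K_{n,𝔭})^{Δ'} = V⁺(F_{n,𝔭})`), hence
`X⁺(V/F_∞) ≅ X⁺(V/K_∞)^Δ ⊕ X⁺(V/K_∞)^η` as `Λ(Γ)`-modules, `X⁺(V/K_∞)^Δ ≅ X⁺(V/ℚ_∞)` likewise
(the tree's flag `Kob03-Thm41-eta1-Ftower`), and characteristic ideals multiply over `⊕`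
(Greenberg LNM 1716 §3 for the descent; folklore). Under this identification Thm. 2.2 (components
`1` and `η`) says `X⁺(V/F_∞)` is finitely generated `Λ`-torsion, and Thm. 4.1, FIRST display at
the character `η`, says `Char_Λ X⁺(V/F_∞) = Char X⁺(V/ℚ_∞) · Char X⁺(V/K_∞)^η ⊇ Char X⁺(V/ℚ_∞) ·
(pⁿ L_p⁺(V, η, X))`, with `n = 0` when `ρ_{V,p^∞}` is onto. The branch function enters through the
tree's `IsQuadraticBranchPlusLFunction f p ϖ Lη` (Kobayashi's `L_p⁺(V, η, X)` up to `u ∈ ℤ_p^×`,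
flag `Kob03-Lplus-eta-upto-unit`; exists by `exists_isQuadraticBranchPlusLFunction_of_isNewformOf`,
unique up to a unit by `QuadraticBranchPlusLFunctionUnique`), so every IDEAL below is the printed one.
"`Gal(ℚ̄/ℚ) → GL_{ℤ_p}(T_pV)` surjective" is spelled `∀ m, V.HasSurjectiveModNGaloisRep (p ^ m)` as in
the `η = 1` sibling and in `kato_divisibility` (3).

## Contents

* §1 (RK⁺) `QuadraticBranchPlusKatoDivisibilityAt V p` — READING of Thm. 2.2 + Thm. 4.1 (`+`, `η`).
* §2 (E⁺) `QuadraticBranchPlusLowerInclusionAt V p` — the OPEN Eisenstein inclusion (our decomposition).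
* §3 bookkeeping, PROVED: (C1_η) ⟹ (E⁺); (RK⁺) ∧ surjectivity ∧ (E⁺) ⟹ (C1_η); hence on the
  surjective-image locus (C1_η) ⟺ (E⁺) granted the reading; and the general form with the integral
  upper inclusion displayed as a hypothesis.

References: [Kobayashi2003] Thm. 2.2 (p. 5), §4 Even main conjecture + Thm. 4.1 (p. 8), Thm. 7.4
and its proof (p. 13), §3 (p. 5), Thm. 3.2/(3.4)/(3.6) (p. 7) — corpus `paper:doi-10-1007-s00222-002-0265-4`
p0005, p0007, p0008, p0013; [Kato2004Asterisque] Thm. 12.5; [PollackRubin2004] Theorem + remark p. 448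
(corpus `paper:arxiv-math_0509604` p0002); [Lei2011Compositio] Conj. 1.1, Cor. 6.9, §7 first sentence
(arXiv:0904.3938); [FouquetWan2021] Thm. 5.1 / 1.7 (claim); [GreenbergLNM1716] §3 (descent; reading).
-/

noncomputable section

open scoped Classical MatrixGroups ModularForm

open CongruenceSubgroup WeierstrassCurve Literature.NumberTheory.EllipticCurves
  Literature.NumberTheory.EllipticCurves.ModularForms
  Literature.NumberTheory.EllipticCurves.Kobayashi2003
  Literature.NumberTheory.EllipticCurves.Rank1Residual
  Literature.NumberTheory.GaloisRepresentations ZpExtension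

namespace Summit.BirchSwinnertonDyer.Rank1Residual.Additive

/-! ## §1 (RK⁺) — Kobayashi Thm. 2.2 + Thm. 4.1, sign `+`, component `η`, read over `ℚ(√p*)` -/

/-- **TYPED INPUT (RK⁺) — READING of Kobayashi 2003 Thm. 2.2 + Thm. 4.1 (sign `+`, component
`η = ω^{(p−1)/2}`), THEOREMS IN PRINT, in the `ℚ(√p*)`-subtower currency of (C1_η); flags
`Kob03-Thm41-eta-quadratic-subtower`, `Kob03-Lplus-eta-upto-unit`; NOTHING asserted.** Verbatim
(Invent. Math. 152, p. 8): "By Theorem 2.2, `X^±(E/K_∞)^η` is a torsion `ℤ_p[[Γ]]`-module. […]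
**Theorem 4.1.** There exists an integer `n ≥ 0` such that `Char(X⁺(E/K_∞)^η) ⊇ (pⁿ L_p⁺(E, η, X))`
[…] If the `p`-adic representation `Gal(ℚ̄/ℚ) → GL_{ℤ_p}(T)` is surjective, then we can take
`n = 0`." Binders = those of `QuadraticBranchPlusMainConjectureAt V p`, word for word: `p` odd, `V`
globally minimal over `ℚ` with good reduction at `p` and `a_p(V) = 0`; `F` a quadratic field with
`θ² = p* = (−1)^{⌊p/2⌋} p`; `V'` any `F`-model of `V_F`; `κ`/`κF` the cyclotomic `ℤ_p`-extensions of
`ℚ`/`F` with topological generators `γ`/`γF` matching the variable `1 + p`; `f` the newform of `V`,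
`ϖ` the period ratio of the parity of `η`, `Lη` ANY function with the interpolation property of
`L_p⁺(V, η, X)`; `D`, `DF` ANY Pontryagin-dual data of `Sel⁺(V/ℚ_∞)`, `Sel⁺(V/F_∞)`. Conclusion,
read through `X⁺(V/F_∞) ≅ X⁺(V/ℚ_∞) ⊕ X⁺(V/K_∞)^η` (module docstring): (a) `X⁺(V/F_∞)` is finitely
generated `Λ`-torsion [Thm. 2.2 at `1` and `η`]; (b) `pⁿ · Char X⁺(V/ℚ_∞) · (Lη) ⊆ Char X⁺(V/F_∞)` for
some `n ≥ 0` [Thm. 4.1, first display, at `η`]; (c) if `ρ_{V,p^∞}` is onto (surjective mod `p^m` for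
every `m`), `Char X⁺(V/ℚ_∞) · (Lη) ⊆ Char X⁺(V/F_∞)` [its last sentence]. The CONVERSE inclusion is
§2, not this statement. STATUS: theorem in print (Kato side of the even main conjecture), typed as a
reading because the prime-to-`p` descent `K_∞ ⊋ F_∞` and the `⊕`-multiplicativity of `Char` are not
formalised in the tree.
[cite: Kobayashi2003, Thm. 4.1 (p. 8) and Thm. 2.2 (p. 5); Def. 2.1 (p. 5), §3 (p. 5), Thm. 3.2 and (3.4)–(3.6) (p. 7), proof of Thm. 7.4 (p. 13); corpus `paper:doi-10-1007-s00222-002-0265-4` p0005, p0008, p0013]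
[cite: Kato2004Asterisque, Thm. 12.5 (the Euler-system input)]
[cite: GreenbergLNM1716, §3 (descent of Selmer groups in prime-to-p extensions; reading)] -/
@[conjecture] def QuadraticBranchPlusKatoDivisibilityAt (V : WeierstrassCurve ℚ) [V.IsElliptic]
    [V.IsGloballyMinimal] (p : ℕ) [Fact p.Prime] : Prop :=
  ∀ (F : Type) [Field F] [NumberField F] (V' : WeierstrassCurve F) [V'.IsElliptic]
    {κ : ZpExtension ℚ p} {γ : Field.absoluteGaloisGroup ℚ}
    {κF : ZpExtension F p} {γF : Field.absoluteGaloisGroup F}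
    {N : ℕ} [NeZero N] {f : CuspForm (Gamma0 N) 2},
    p ≠ 2 → V.HasGoodReductionAtPrime p → V.frobeniusTrace p = 0 →
    Module.finrank ℚ F = 2 → (∃ θ : F, θ ^ 2 = algebraMap ℚ F ((-1) ^ (p / 2) * p)) →
    (∃ C : VariableChange F, C • V.baseChange F = V') →
    κ.IsCyclotomic → κ.IsTopGenerator γ → IsCyclotomicVariable p γ →
    κF.IsCyclotomic → κF.IsTopGenerator γF →
    (∃ ζ : ℤ_[p]ˣ, IsOfFinOrder ζ ∧
      ((GaloisRep.cyclotomicCharacter F p γF * ζ : ℤ_[p]ˣ) : ℤ_[p]) =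
        (cyclotomicGenerator p : ℤ_[p])) →
    IsNewformOf V f →
    ∀ (ϖ : ℚ), (if Even (p / 2) then (ϖ : ℝ) * V.realPeriodRat = plusPeriod f
        else (ϖ : ℝ) * V.imaginaryPeriodRat = minusPeriod f) →
    ∀ (Lη : IwasawaAlgebra p), IsQuadraticBranchPlusLFunction f p ϖ Lη →
    ∀ (D : SignedSelmerDualData V κ γ 1) (DF : SignedSelmerDualData V' κF γF 1),
      Module.Finite (IwasawaAlgebra p) DF.X ∧ Module.IsTorsion (IwasawaAlgebra p) DF.X ∧
        (∃ n : ℕ, Ideal.span {(p : IwasawaAlgebra p) ^ n} * (D.charIdeal * Ideal.span {Lη}) ≤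
          DF.charIdeal) ∧
        ((∀ m : ℕ, V.HasSurjectiveModNGaloisRep (p ^ m : ℕ)) →
          D.charIdeal * Ideal.span {Lη} ≤ DF.charIdeal)

/-! ## §2 (E⁺) — the Eisenstein inclusion on the quadratic branch (OPEN; our decomposition) -/

/-- **TYPED STATEMENT (E⁺) — the LOWER ("Eisenstein") inclusion of (C1_η), OUR DECOMPOSITION of
the printed conjecture (not a statement in print as such); OPEN for non-CM `V`; NOTHING asserted.**
With the binders of `QuadraticBranchPlusMainConjectureAt V p` word for word:
**`Char_Λ X⁺(V/F_∞) ⊆ Char_Λ X⁺(V/ℚ_∞) · (L_p⁺(V, η, X))`** — under the descent reading the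
`η`-component inclusion `Char(X⁺(V/K_∞)^η) ⊆ (L_p⁺(V, η, X))`, i.e. the half of Kobayashi's even main
conjecture (§4, p. 8: "For every `η`, we have `Char(X⁺(E/K_∞)^η) = (L_p⁺(E, η, X))`") that Kato's
Euler system does NOT give; by the proof of his Thm. 7.4 (p. 13) it is the `η`-component of the
inclusion `char H² ⊆ char(H¹/Z)` of Kato's main conjecture (Astérisque 295, Conj. 12.10), equivalently
Kato's lower inclusion for the ADDITIVE twist `W = V ⊗ χ_{p*}` at `p`. STATUS: OPEN — the proved cases
of the `±`/Kato main conjecture (Wan; Sprung; Castella–Çiperiani–Skinner–Sprung; Burungale–Skinner–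
Tian–Wan arXiv:2409.01350, PRE) are on the trivial component of `Δ`; Fouquet–Wan arXiv:2107.13726
Thm. 5.1 CLAIMS Kato's IMC at level `Np^r` (arbitrary reduction at `p`) on the locus `ρ̄` abs.
irreducible + a non-split multiplicative prime with `E[p]` ramified (UNREFEREED; tree
`FouquetWanClaimShape`, hypothesis only); for CM `V` it is Pollack–Rubin's printed REMARK (Ann. of
Math. 159 (2004) p. 448), not a theorem of record. This is the statement the rank-`0` lower half on
Gss2 actually consumes (`Char X ⊆ (L)` ⟹ `v_p L(0) ≤ ord_p #Sel + ord_p(Tam/#tors²)`).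
[cite: Kobayashi2003, §4 Even main conjecture (p. 8) and the proof of Thm. 7.4 (p. 13); shape only, nothing asserted]
[cite: Kato2004Asterisque, Conj. 12.10 (p. 224; shape only)]
[cite: PollackRubin2004, Theorem and the remark on Sel over ℚ(μ_{p^∞}) (p. 448)] -/
@[conjecture] def QuadraticBranchPlusLowerInclusionAt (V : WeierstrassCurve ℚ) [V.IsElliptic]
    [V.IsGloballyMinimal] (p : ℕ) [Fact p.Prime] : Prop :=
  ∀ (F : Type) [Field F] [NumberField F] (V' : WeierstrassCurve F) [V'.IsElliptic]
    {κ : ZpExtension ℚ p} {γ : Field.absoluteGaloisGroup ℚ}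
    {κF : ZpExtension F p} {γF : Field.absoluteGaloisGroup F}
    {N : ℕ} [NeZero N] {f : CuspForm (Gamma0 N) 2},
    p ≠ 2 → V.HasGoodReductionAtPrime p → V.frobeniusTrace p = 0 →
    Module.finrank ℚ F = 2 → (∃ θ : F, θ ^ 2 = algebraMap ℚ F ((-1) ^ (p / 2) * p)) →
    (∃ C : VariableChange F, C • V.baseChange F = V') →
    κ.IsCyclotomic → κ.IsTopGenerator γ → IsCyclotomicVariable p γ →
    κF.IsCyclotomic → κF.IsTopGenerator γF →
    (∃ ζ : ℤ_[p]ˣ, IsOfFinOrder ζ ∧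
      ((GaloisRep.cyclotomicCharacter F p γF * ζ : ℤ_[p]ˣ) : ℤ_[p]) =
        (cyclotomicGenerator p : ℤ_[p])) →
    IsNewformOf V f →
    ∀ (ϖ : ℚ), (if Even (p / 2) then (ϖ : ℝ) * V.realPeriodRat = plusPeriod f
        else (ϖ : ℝ) * V.imaginaryPeriodRat = minusPeriod f) →
    ∀ (Lη : IwasawaAlgebra p), IsQuadraticBranchPlusLFunction f p ϖ Lη →
    ∀ (D : SignedSelmerDualData V κ γ 1) (DF : SignedSelmerDualData V' κF γF 1),
      DF.charIdeal ≤ D.charIdeal * Ideal.span {Lη}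

/-! ## §3 Bookkeeping: `(C1_η) ⟺ Kato half ∧ Eisenstein half` -/

section Bookkeeping

variable {V : WeierstrassCurve ℚ} [V.IsElliptic] [V.IsGloballyMinimal] {p : ℕ} [Fact p.Prime]

/-- **(C1_η) ⟹ (E⁺)**: the equality of ideals gives the lower inclusion (modus ponens on the same
binders; CONDITIONAL on the typed conjecture, nothing booked).
[cite: Kobayashi2003, §4 Even main conjecture (p. 8); shape only] -/
theorem quadraticBranchPlusLowerInclusionAt_of_plusMainConjectureAt
    (h : QuadraticBranchPlusMainConjectureAt V p) : QuadraticBranchPlusLowerInclusionAt V p := by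
  intro F _ _ V' _ κ γ κF γF N _ f hp hgood hap hF hθ hC hκ hγ hγc hκF hγF hζ hf ϖ hϖ Lη hL D DF
  exact (h F V' hp hgood hap hF hθ hC hκ hγ hγc hκF hγF hζ hf ϖ hϖ Lη hL D DF).2.2.le

/-- **The upper (Kato) inclusion from the reading (RK⁺) on the surjective-image locus**: granted
(RK⁺), if `ρ_{V,p^∞}` is onto then, on the binders of (C1_η), `X⁺(V/F_∞)` is finitely generated
`Λ`-torsion and `Char X⁺(V/ℚ_∞) · (Lη) ⊆ Char X⁺(V/F_∞)` — Thm. 4.1 with "`n = 0`", as a function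
of the reading. [cite: Kobayashi2003, Thm. 4.1 (p. 8), last sentence] -/
theorem QuadraticBranchPlusKatoDivisibilityAt.integral (hK : QuadraticBranchPlusKatoDivisibilityAt V p)
    (hsurj : ∀ m : ℕ, V.HasSurjectiveModNGaloisRep (p ^ m : ℕ))
    (F : Type) [Field F] [NumberField F] (V' : WeierstrassCurve F) [V'.IsElliptic]
    {κ : ZpExtension ℚ p} {γ : Field.absoluteGaloisGroup ℚ}
    {κF : ZpExtension F p} {γF : Field.absoluteGaloisGroup F}
    {N : ℕ} [NeZero N] {f : CuspForm (Gamma0 N) 2}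
    (hp : p ≠ 2) (hgood : V.HasGoodReductionAtPrime p) (hap : V.frobeniusTrace p = 0)
    (hF : Module.finrank ℚ F = 2) (hθ : ∃ θ : F, θ ^ 2 = algebraMap ℚ F ((-1) ^ (p / 2) * p))
    (hC : ∃ C : VariableChange F, C • V.baseChange F = V')
    (hκ : κ.IsCyclotomic) (hγ : κ.IsTopGenerator γ) (hγc : IsCyclotomicVariable p γ)
    (hκF : κF.IsCyclotomic) (hγF : κF.IsTopGenerator γF)
    (hζ : ∃ ζ : ℤ_[p]ˣ, IsOfFinOrder ζ ∧
      ((GaloisRep.cyclotomicCharacter F p γF * ζ : ℤ_[p]ˣ) : ℤ_[p]) =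
        (cyclotomicGenerator p : ℤ_[p]))
    (hf : IsNewformOf V f) (ϖ : ℚ)
    (hϖ : if Even (p / 2) then (ϖ : ℝ) * V.realPeriodRat = plusPeriod f
        else (ϖ : ℝ) * V.imaginaryPeriodRat = minusPeriod f)
    (Lη : IwasawaAlgebra p) (hL : IsQuadraticBranchPlusLFunction f p ϖ Lη)
    (D : SignedSelmerDualData V κ γ 1) (DF : SignedSelmerDualData V' κF γF 1) :
    Module.Finite (IwasawaAlgebra p) DF.X ∧ Module.IsTorsion (IwasawaAlgebra p) DF.X ∧
      D.charIdeal * Ideal.span {Lη} ≤ DF.charIdeal := by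
  obtain ⟨hfin, htor, -, hint⟩ := hK F V' hp hgood hap hF hθ hC hκ hγ hγc hκF hγF hζ hf ϖ hϖ Lη hL D DF
  exact ⟨hfin, htor, hint hsurj⟩

/-- **(RK⁺) ∧ `ρ_{V,p^∞}` onto ∧ (E⁺) ⟹ (C1_η).** Granted the reading of Kobayashi's Thm. 2.2 + 4.1
at `η` and surjectivity of the `p`-adic representation of `V`, the OPEN Eisenstein inclusion (E⁺) is
ALL that separates the tree from (C1_η) `QuadraticBranchPlusMainConjectureAt V p`: finite generation
and torsion are clause (a) of the reading, `⊇` is clause (c), `⊆` is (E⁺), and two inclusions give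
the equality of ideals. CONDITIONAL on both typed inputs; closes nothing by itself.
[cite: Kobayashi2003, Thm. 2.2 (p. 5), Thm. 4.1 and §4 Even main conjecture (p. 8)] -/
theorem quadraticBranchPlusMainConjectureAt_of_katoDivisibility_of_lowerInclusion
    (hK : QuadraticBranchPlusKatoDivisibilityAt V p)
    (hsurj : ∀ m : ℕ, V.HasSurjectiveModNGaloisRep (p ^ m : ℕ))
    (hE : QuadraticBranchPlusLowerInclusionAt V p) : QuadraticBranchPlusMainConjectureAt V p := by
  intro F _ _ V' _ κ γ κF γF N _ f hp hgood hap hF hθ hC hκ hγ hγc hκF hγF hζ hf ϖ hϖ Lη hL D DF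
  obtain ⟨hfin, htor, hup⟩ :=
    hK.integral hsurj F V' hp hgood hap hF hθ hC hκ hγ hγc hκF hγF hζ hf ϖ hϖ Lη hL D DF
  exact ⟨hfin, htor,
    le_antisymm (hE F V' hp hgood hap hF hθ hC hκ hγ hγc hκF hγF hζ hf ϖ hϖ Lη hL D DF) hup⟩

/-- **On the surjective-image locus, (C1_η) ⟺ (E⁺) granted the reading (RK⁺).** The Kato half of
the crux is a theorem in print; the crux IS its Eisenstein half there. (At `p ≥ 5` and `V` non-CM
good supersingular, `ρ_{V,p^∞}` is onto for all but finitely many `p` — Serre; census-decidable per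
pair. Off the locus see `…_of_upper_of_lower`.) CONDITIONAL; nothing booked.
[cite: Kobayashi2003, Thm. 4.1 and §4 Even main conjecture (p. 8)] -/
theorem quadraticBranchPlusMainConjectureAt_iff_lowerInclusion_of_katoDivisibility
    (hK : QuadraticBranchPlusKatoDivisibilityAt V p)
    (hsurj : ∀ m : ℕ, V.HasSurjectiveModNGaloisRep (p ^ m : ℕ)) :
    QuadraticBranchPlusMainConjectureAt V p ↔ QuadraticBranchPlusLowerInclusionAt V p :=
  ⟨quadraticBranchPlusLowerInclusionAt_of_plusMainConjectureAt,
    quadraticBranchPlusMainConjectureAt_of_katoDivisibility_of_lowerInclusion hK hsurj⟩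

/-- **Off the surjective-image locus** (e.g. the CM rows, where `ρ_{V,p^∞}` is never onto and Thm.
4.1 only gives `pⁿ`): granted the reading (RK⁺) for finite generation and torsion, (C1_η) follows
from the Eisenstein inclusion (E⁺) together with the INTEGRAL upper inclusion
`Char X⁺(V/ℚ_∞)·(Lη) ⊆ Char X⁺(V/F_∞)` DISPLAYED as a hypothesis `hup` on the same binders (itself a
consequence of (C1_η); with (E⁺) and clause (b) of the reading it says the two characteristic power
series have the same `μ`-invariant). CONDITIONAL; nothing booked.
[cite: Kobayashi2003, Thm. 2.2 (p. 5), Thm. 4.1 and §4 Even main conjecture (p. 8)] -/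
theorem quadraticBranchPlusMainConjectureAt_of_upper_of_lower
    (hK : QuadraticBranchPlusKatoDivisibilityAt V p)
    (hup : ∀ (F : Type) [Field F] [NumberField F] (V' : WeierstrassCurve F) [V'.IsElliptic]
      {κ : ZpExtension ℚ p} {γ : Field.absoluteGaloisGroup ℚ}
      {κF : ZpExtension F p} {γF : Field.absoluteGaloisGroup F}
      {N : ℕ} [NeZero N] {f : CuspForm (Gamma0 N) 2},
      p ≠ 2 → V.HasGoodReductionAtPrime p → V.frobeniusTrace p = 0 →
      Module.finrank ℚ F = 2 → (∃ θ : F, θ ^ 2 = algebraMap ℚ F ((-1) ^ (p / 2) * p)) →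
      (∃ C : VariableChange F, C • V.baseChange F = V') →
      κ.IsCyclotomic → κ.IsTopGenerator γ → IsCyclotomicVariable p γ →
      κF.IsCyclotomic → κF.IsTopGenerator γF →
      (∃ ζ : ℤ_[p]ˣ, IsOfFinOrder ζ ∧
        ((GaloisRep.cyclotomicCharacter F p γF * ζ : ℤ_[p]ˣ) : ℤ_[p]) =
          (cyclotomicGenerator p : ℤ_[p])) →
      IsNewformOf V f →
      ∀ (ϖ : ℚ), (if Even (p / 2) then (ϖ : ℝ) * V.realPeriodRat = plusPeriod f
          else (ϖ : ℝ) * V.imaginaryPeriodRat = minusPeriod f) →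
      ∀ (Lη : IwasawaAlgebra p), IsQuadraticBranchPlusLFunction f p ϖ Lη →
      ∀ (D : SignedSelmerDualData V κ γ 1) (DF : SignedSelmerDualData V' κF γF 1),
        D.charIdeal * Ideal.span {Lη} ≤ DF.charIdeal)
    (hE : QuadraticBranchPlusLowerInclusionAt V p) : QuadraticBranchPlusMainConjectureAt V p := by
  intro F _ _ V' _ κ γ κF γF N _ f hp hgood hap hF hθ hC hκ hγ hγc hκF hγF hζ hf ϖ hϖ Lη hL D DF
  obtain ⟨hfin, htor, -, -⟩ :=
    hK F V' hp hgood hap hF hθ hC hκ hγ hγc hκF hγF hζ hf ϖ hϖ Lη hL D DF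
  exact ⟨hfin, htor,
    le_antisymm (hE F V' hp hgood hap hF hθ hC hκ hγ hγc hκF hγF hζ hf ϖ hϖ Lη hL D DF)
      (hup F V' hp hgood hap hF hθ hC hκ hγ hγc hκF hγF hζ hf ϖ hϖ Lη hL D DF)⟩

/-- **The rational form of the Kato half as a divisibility of characteristic power series** (the
shape the census reads): granted (RK⁺), for characteristic power series `g` of `X⁺(V/F_∞)`
(`Char = (g)`) and `ξ` of `X⁺(V/ℚ_∞)` (`Char = (ξ)`), **`g ∣ pⁿ · ξ · Lη` for some `n ≥ 0`**
(`Ideal.span_singleton_mul_span_singleton`, `Ideal.span_singleton_le_span_singleton`).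
[cite: Kobayashi2003, Thm. 4.1 (p. 8), first display] -/
theorem QuadraticBranchPlusKatoDivisibilityAt.exists_dvd_pow_mul
    (hK : QuadraticBranchPlusKatoDivisibilityAt V p)
    (F : Type) [Field F] [NumberField F] (V' : WeierstrassCurve F) [V'.IsElliptic]
    {κ : ZpExtension ℚ p} {γ : Field.absoluteGaloisGroup ℚ}
    {κF : ZpExtension F p} {γF : Field.absoluteGaloisGroup F}
    {N : ℕ} [NeZero N] {f : CuspForm (Gamma0 N) 2}
    (hp : p ≠ 2) (hgood : V.HasGoodReductionAtPrime p) (hap : V.frobeniusTrace p = 0)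
    (hF : Module.finrank ℚ F = 2) (hθ : ∃ θ : F, θ ^ 2 = algebraMap ℚ F ((-1) ^ (p / 2) * p))
    (hC : ∃ C : VariableChange F, C • V.baseChange F = V')
    (hκ : κ.IsCyclotomic) (hγ : κ.IsTopGenerator γ) (hγc : IsCyclotomicVariable p γ)
    (hκF : κF.IsCyclotomic) (hγF : κF.IsTopGenerator γF)
    (hζ : ∃ ζ : ℤ_[p]ˣ, IsOfFinOrder ζ ∧
      ((GaloisRep.cyclotomicCharacter F p γF * ζ : ℤ_[p]ˣ) : ℤ_[p]) =
        (cyclotomicGenerator p : ℤ_[p]))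
    (hf : IsNewformOf V f) (ϖ : ℚ)
    (hϖ : if Even (p / 2) then (ϖ : ℝ) * V.realPeriodRat = plusPeriod f
        else (ϖ : ℝ) * V.imaginaryPeriodRat = minusPeriod f)
    (Lη : IwasawaAlgebra p) (hL : IsQuadraticBranchPlusLFunction f p ϖ Lη)
    (D : SignedSelmerDualData V κ γ 1) (DF : SignedSelmerDualData V' κF γF 1)
    {g ξ : IwasawaAlgebra p} (hg : DF.charIdeal = Ideal.span {g}) (hξ : D.charIdeal = Ideal.span {ξ}) :
    ∃ n : ℕ, g ∣ (p : IwasawaAlgebra p) ^ n * ξ * Lη := by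
  obtain ⟨-, -, ⟨n, hn⟩, -⟩ :=
    hK F V' hp hgood hap hF hθ hC hκ hγ hγc hκF hγF hζ hf ϖ hϖ Lη hL D DF
  refine ⟨n, ?_⟩
  rw [hg, hξ, Ideal.span_singleton_mul_span_singleton, Ideal.span_singleton_mul_span_singleton,
    Ideal.span_singleton_le_span_singleton, ← mul_assoc] at hn
  exact hn

end Bookkeeping

end Summit.BirchSwinnertonDyer.Rank1Residual.Additive

end
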